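import Summits.AnomalousDissipation.AnomalousDissipation.Theorems.MarginalStabilityChainStrainedLayerLawStubVorticityUniformBoundsH
import Summits.AnomalousDissipation.AnomalousDissipation.Theorems.MarginalStabilityChainStrainedLayerLawStubVorticityUniformBoundsL
import Summits.AnomalousDissipation.AnomalousDissipation.Theorems.MarginalStabilityChainStrainedLayerLawStubVorticityUniformBoundsJ

/-!
# Stub `stub_vorticityUniformBounds` (crux stmt-AnomalousDissipation-3007, line `strain-work-sum-rule`) — tools N:
# the Nash bound for `ωψ_R` and the uniform-in-time enstrophy bound

Support file (`--supports stmt-AnomalousDissipation-3007`; registered sub-goal `stub_vorticityUniformBounds_enstrophy`), step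
(c′) of the a-priori chain, PROVED: `∃ B, ∀ t ≥ 1, ∫_{(0,L]}∫_ℝ ω(t)² ≤ B` for every classical solution of the stretched
layer system on `(0,∞)` with uniform shear tails on compact time intervals.
* `kato_nash_slice`: for `f = ωψ` (tails, cutoff, `∫∫|ω| ≤ A₀`): `F₂³ ≤ A₀²(2L⁻¹F₂√F₂√P_f + 4F₂P_f)` (tools I, J);
* the theorem: with `A₀ = ‖ω(½)‖₁ + 1 ≥ ‖ω(τ)‖₁` (Kato, tools H), the cut-off enstrophy `N_R = ∫∫ω²ψ_R²` has
  `N_R′ ≤ F₂ − ν‖∇(ωψ_R)‖² + c/R` (tools L), and `F₂ − 2(ν/4)‖∇f‖² < 0` above `K(A₀, ν, L)` (tools J); so `N_R′ < 0`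
  wherever `N_R > K` once `c/R ≤ 1`; the barrier on `[1, t]` and `R → ∞` give `∫∫ω(t)² ≤ max(∫∫ω(1)², K)`.
All `[folklore]`.
-/

-- `Summit.<Summit>.<Problem>` is the tree's mandated summit-side namespace (CONVENTIONS §2); for this
-- single-conjunct summit the two coincide, so the duplicate is deliberate.
set_option linter.dupNamespace false

noncomputable section

open scoped Topology ENNReal
open Filter Set Function MeasureTheory

namespace Summit.AnomalousDissipation.AnomalousDissipation.Theorems.StrainedLayerLaw.StrainWorkSumRule

open Literature.Analysis.FluidPDE Literature.Analysis.FluidPDE.StretchedLayer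
open Summit.AnomalousDissipation.AnomalousDissipation.Theorems.MarginalStabilityChainStretchedVortexRows

/-! ## The Nash bound for the cut-off vorticity slice -/

section NashSlice

variable {L : ℝ}

/-- **Nash-type bound for `f = ωψ`.** For a `C¹` vorticity slice `ω`, `L`-periodic in `x`, with tails
`|ω|, |∂ₓω|, |∂_yω| ≤ Ce^{−k|y|}`, a cutoff `ψ` (`C¹`, `|ψ| ≤ 1`, `|ψ′| ≤ D`) and `∫∫|ω| ≤ A₀`: with
`F₂ = ∫∫ (ωψ)²`, `P_f = ∫∫ |∇(ωψ)|²`: `F₂³ ≤ A₀²(2L⁻¹F₂√F₂√P_f + 4F₂P_f)` (tools I and the `L²–L¹–L⁴`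
interpolation of tools J). [folklore] -/
theorem kato_nash_slice (hL : 0 < L) {C k : ℝ} (hk : 0 < k) {ω : ℝ → ℝ → ℝ}
    (hω : ContDiff ℝ 1 (fun q : ℝ × ℝ => ω q.1 q.2)) (hper : ∀ x y, ω (x + L) y = ω x y)
    (hωb : ∀ x y, |ω x y| ≤ C * Real.exp (-k * |y|)) (hωx : ∀ x y, |dX ω x y| ≤ C * Real.exp (-k * |y|))
    (hωy : ∀ x y, |dY ω x y| ≤ C * Real.exp (-k * |y|)) {ψ : ℝ → ℝ} (hψ : ContDiff ℝ 1 ψ)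
    (hψ1 : ∀ y, |ψ y| ≤ 1) {D : ℝ} (hD : 0 ≤ D) (hψ'b : ∀ y, |deriv ψ y| ≤ D) {A₀ : ℝ}
    (hA : ∫ q in Ioc 0 L ×ˢ univ, |ω q.1 q.2| ≤ A₀) :
    (∫ q in Ioc 0 L ×ˢ univ, (ω q.1 q.2 * ψ q.2) ^ 2) ^ 3 ≤
      A₀ ^ 2 * (2 * L⁻¹ * ((∫ q in Ioc 0 L ×ˢ univ, (ω q.1 q.2 * ψ q.2) ^ 2) *
        Real.sqrt (∫ q in Ioc 0 L ×ˢ univ, (ω q.1 q.2 * ψ q.2) ^ 2)) *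
        Real.sqrt (∫ q in Ioc 0 L ×ˢ univ, (dX (fun x y => ω x y * ψ y) q.1 q.2 ^ 2 +
          dY (fun x y => ω x y * ψ y) q.1 q.2 ^ 2)) +
        4 * (∫ q in Ioc 0 L ×ˢ univ, (ω q.1 q.2 * ψ q.2) ^ 2) *
          ∫ q in Ioc 0 L ×ˢ univ, (dX (fun x y => ω x y * ψ y) q.1 q.2 ^ 2 +
            dY (fun x y => ω x y * ψ y) q.1 q.2 ^ 2)) := by
  have hC : 0 ≤ C := by
    have h := (abs_nonneg _).trans (hωb 0 0)
    rw [abs_zero, mul_zero, Real.exp_zero, mul_one] at h; exact h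
  set f : ℝ → ℝ → ℝ := fun x y => ω x y * ψ y with hfdef
  have hf : ContDiff ℝ 1 (fun q : ℝ × ℝ => f q.1 q.2) := hω.mul (hψ.comp contDiff_snd)
  have cf : Continuous fun q : ℝ × ℝ => f q.1 q.2 := hf.continuous
  have hfper : ∀ x y, f (x + L) y = f x y := fun x y => by simp only [hfdef, hper]
  have hψd : ∀ y, HasDerivAt ψ (deriv ψ y) y := fun y => (hψ.differentiable one_ne_zero y).hasDerivAt
  have hfx : ∀ x y, dX f x y = dX ω x y * ψ y := fun x y =>
    ((hasDerivAt_dX_of_contDiff hω one_ne_zero x y).mul_const (ψ y)).deriv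
  have hfy : ∀ x y, dY f x y = dY ω x y * ψ y + ω x y * deriv ψ y := fun x y =>
    ((hasDerivAt_dY_of_contDiff hω one_ne_zero x y).mul (hψd y)).deriv
  -- tails of `f`
  have hle1 : ∀ y : ℝ, Real.exp (-k * |y|) ≤ 1 := fun y => Real.exp_le_one_iff.2 (by nlinarith [abs_nonneg y])
  have hCD : 0 ≤ C * (2 + D) := by positivity
  have h12 : (1:ℝ) ≤ 2 + D := by linarith
  have hfb : ∀ x y, |f x y| ≤ C * (2 + D) * Real.exp (-k * |y|) := fun x y => by
    simp only [hfdef]; rw [abs_mul]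
    calc |ω x y| * |ψ y| ≤ C * Real.exp (-k * |y|) * 1 := mul_le_mul (hωb x y) (hψ1 y) (abs_nonneg _) (by positivity)
      _ ≤ C * Real.exp (-k * |y|) * (2 + D) := mul_le_mul_of_nonneg_left h12 (by positivity)
      _ = C * (2 + D) * Real.exp (-k * |y|) := by ring
  have cfx : Continuous fun q : ℝ × ℝ => dX f q.1 q.2 := continuous_dX hf
  have cfy : Continuous fun q : ℝ × ℝ => dY f q.1 q.2 := continuous_dY hf
  have hfgrad : ∀ x y, |dX f x y| + |dY f x y| ≤ C * (2 + D) * Real.exp (-k * |y|) := fun x y => by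
    rw [hfx, hfy]
    have h1 : |dX ω x y * ψ y| ≤ C * Real.exp (-k * |y|) := by
      rw [abs_mul]
      calc |dX ω x y| * |ψ y| ≤ C * Real.exp (-k * |y|) * 1 := mul_le_mul (hωx x y) (hψ1 y) (abs_nonneg _) (by positivity)
        _ = _ := mul_one _
    have h2 : |dY ω x y * ψ y + ω x y * deriv ψ y| ≤ C * Real.exp (-k * |y|) + C * Real.exp (-k * |y|) * D := by
      refine (abs_add_le _ _).trans (add_le_add ?_ ?_)
      · rw [abs_mul]
        calc |dY ω x y| * |ψ y| ≤ C * Real.exp (-k * |y|) * 1 := mul_le_mul (hωy x y) (hψ1 y) (abs_nonneg _) (by positivity)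
          _ = _ := mul_one _
      · rw [abs_mul]; exact mul_le_mul (hωb x y) (hψ'b y) (abs_nonneg _) (by positivity)
    calc |dX ω x y * ψ y| + |dY ω x y * ψ y + ω x y * deriv ψ y|
        ≤ C * Real.exp (-k * |y|) + (C * Real.exp (-k * |y|) + C * Real.exp (-k * |y|) * D) := add_le_add h1 h2
      _ = C * (2 + D) * Real.exp (-k * |y|) := by ring
  -- Ladyzhenskaya (tools I)
  have hLady := stub_vorticityUniformBounds_ladyzhenskaya L (C * (2 + D)) k f hL hk hf hfper hfb hfgrad
  -- integrability for the interpolation (tools J)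
  have hwI : ∀ (F : ℝ × ℝ → ℝ) (M : ℝ), Continuous F → 0 ≤ M → (∀ x y, |F (x, y)| ≤ M * Real.exp (-k * |y|)) →
      IntegrableOn F (Ioc 0 L ×ˢ univ) := fun F M hF hM hb =>
    integrableOn_strip_of_abs_le_exp hF hM hk fun x _ y => hb x y
  have hfC : ∀ x y, |f x y| ≤ C * (2 + D) := fun x y => (hfb x y).trans (mul_le_of_le_one_right hCD (hle1 y))
  have i1 : IntegrableOn (fun q : ℝ × ℝ => |f q.1 q.2|) (Ioc 0 L ×ˢ univ) :=
    hwI _ _ (by fun_prop) hCD fun x y => by rw [abs_abs]; exact hfb x y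
  have i2 : IntegrableOn (fun q : ℝ × ℝ => f q.1 q.2 ^ 2) (Ioc 0 L ×ˢ univ) := by
    refine hwI _ ((C * (2 + D)) ^ 2) (by fun_prop) (by positivity) fun x y => ?_
    rw [abs_of_nonneg (sq_nonneg _)]
    calc f x y ^ 2 = |f x y| * |f x y| := by rw [← sq, sq_abs]
      _ ≤ C * (2 + D) * (C * (2 + D) * Real.exp (-k * |y|)) := mul_le_mul (hfC x y) (hfb x y) (abs_nonneg _) hCD
      _ = (C * (2 + D)) ^ 2 * Real.exp (-k * |y|) := by ring
  have i3 : IntegrableOn (fun q : ℝ × ℝ => |f q.1 q.2| ^ 3) (Ioc 0 L ×ˢ univ) := by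
    refine hwI _ ((C * (2 + D)) ^ 3) (by fun_prop) (by positivity) fun x y => ?_
    rw [abs_of_nonneg (by positivity)]
    calc |f x y| ^ 3 = |f x y| ^ 2 * |f x y| := by ring
      _ ≤ (C * (2 + D)) ^ 2 * (C * (2 + D) * Real.exp (-k * |y|)) :=
          mul_le_mul (pow_le_pow_left₀ (abs_nonneg _) (hfC x y) 2) (hfb x y) (abs_nonneg _) (by positivity)
      _ = (C * (2 + D)) ^ 3 * Real.exp (-k * |y|) := by ring
  have i4 : IntegrableOn (fun q : ℝ × ℝ => f q.1 q.2 ^ 4) (Ioc 0 L ×ˢ univ) := by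
    refine hwI _ ((C * (2 + D)) ^ 4) (by fun_prop) (by positivity) fun x y => ?_
    rw [abs_of_nonneg (by positivity)]
    calc f x y ^ 4 = |f x y| ^ 3 * |f x y| := by
          rw [show f x y ^ 4 = |f x y| ^ 4 by rw [pow_abs, abs_of_nonneg (by positivity)]]; ring
      _ ≤ (C * (2 + D)) ^ 3 * (C * (2 + D) * Real.exp (-k * |y|)) :=
          mul_le_mul (pow_le_pow_left₀ (abs_nonneg _) (hfC x y) 3) (hfb x y) (abs_nonneg _) (by positivity)
      _ = (C * (2 + D)) ^ 4 * Real.exp (-k * |y|) := by ring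
  have hInterp := stub_vorticityUniformBounds_nashInterpolation (L := L) (f := fun q : ℝ × ℝ => f q.1 q.2) cf i1 i2 i3 i4
  -- notation
  set F₂ : ℝ := ∫ q in Ioc 0 L ×ˢ univ, f q.1 q.2 ^ 2 with hF₂
  set FX : ℝ := ∫ q in Ioc 0 L ×ˢ univ, dX f q.1 q.2 ^ 2 with hFX
  set FY : ℝ := ∫ q in Ioc 0 L ×ˢ univ, dY f q.1 q.2 ^ 2 with hFY
  set F4 : ℝ := ∫ q in Ioc 0 L ×ˢ univ, f q.1 q.2 ^ 4 with hF4
  set I1 : ℝ := ∫ q in Ioc 0 L ×ˢ univ, |f q.1 q.2| with hI1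
  have hS : MeasurableSet (Ioc (0:ℝ) L ×ˢ (univ : Set ℝ)) := measurableSet_Ioc.prod MeasurableSet.univ
  have hF₂0 : 0 ≤ F₂ := setIntegral_nonneg hS fun q _ => sq_nonneg _
  have hFX0 : 0 ≤ FX := setIntegral_nonneg hS fun q _ => sq_nonneg _
  have hFY0 : 0 ≤ FY := setIntegral_nonneg hS fun q _ => sq_nonneg _
  have hI10 : 0 ≤ I1 := setIntegral_nonneg hS fun q _ => abs_nonneg _
  -- `I1 ≤ A₀`
  have hωI : IntegrableOn (fun q : ℝ × ℝ => |ω q.1 q.2|) (Ioc 0 L ×ˢ univ) :=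
    hwI _ C (hω.continuous.abs) hC fun x y => by rw [abs_abs]; exact hωb x y
  have hI1A : I1 ≤ A₀ := by
    refine (integral_mono i1 hωI fun q => ?_).trans hA
    simp only [hfdef]; rw [abs_mul]
    exact mul_le_of_le_one_right (abs_nonneg _) (hψ1 _)
  -- `FX, FY ≤ P_f = FX + FY`
  have iFX : IntegrableOn (fun q : ℝ × ℝ => dX f q.1 q.2 ^ 2) (Ioc 0 L ×ˢ univ) := by
    refine hwI _ ((C * (2 + D)) ^ 2) (by fun_prop) (by positivity) fun x y => ?_
    rw [abs_of_nonneg (sq_nonneg _)]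
    have h1 : |dX f x y| ≤ C * (2 + D) * Real.exp (-k * |y|) := by linarith [hfgrad x y, abs_nonneg (dY f x y)]
    have h2 : |dX f x y| ≤ C * (2 + D) := h1.trans (mul_le_of_le_one_right hCD (hle1 y))
    calc dX f x y ^ 2 = |dX f x y| * |dX f x y| := by rw [← sq, sq_abs]
      _ ≤ C * (2 + D) * (C * (2 + D) * Real.exp (-k * |y|)) := mul_le_mul h2 h1 (abs_nonneg _) hCD
      _ = (C * (2 + D)) ^ 2 * Real.exp (-k * |y|) := by ring
  have iFY : IntegrableOn (fun q : ℝ × ℝ => dY f q.1 q.2 ^ 2) (Ioc 0 L ×ˢ univ) := by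
    refine hwI _ ((C * (2 + D)) ^ 2) (by fun_prop) (by positivity) fun x y => ?_
    rw [abs_of_nonneg (sq_nonneg _)]
    have h1 : |dY f x y| ≤ C * (2 + D) * Real.exp (-k * |y|) := by linarith [hfgrad x y, abs_nonneg (dX f x y)]
    have h2 : |dY f x y| ≤ C * (2 + D) := h1.trans (mul_le_of_le_one_right hCD (hle1 y))
    calc dY f x y ^ 2 = |dY f x y| * |dY f x y| := by rw [← sq, sq_abs]
      _ ≤ C * (2 + D) * (C * (2 + D) * Real.exp (-k * |y|)) := mul_le_mul h2 h1 (abs_nonneg _) hCD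
      _ = (C * (2 + D)) ^ 2 * Real.exp (-k * |y|) := by ring
  have hP : ∫ q in Ioc 0 L ×ˢ univ, (dX f q.1 q.2 ^ 2 + dY f q.1 q.2 ^ 2) = FX + FY := integral_add iFX iFY
  rw [hP]
  have hsX : Real.sqrt FX ≤ Real.sqrt (FX + FY) := Real.sqrt_le_sqrt (by linarith)
  have hsY : Real.sqrt FY ≤ Real.sqrt (FX + FY) := Real.sqrt_le_sqrt (by linarith)
  have hsF : Real.sqrt F₂ * Real.sqrt F₂ = F₂ := Real.mul_self_sqrt hF₂0
  have hsP : Real.sqrt (FX + FY) * Real.sqrt (FX + FY) = FX + FY := Real.mul_self_sqrt (by linarith)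
  have hsF0 : 0 ≤ Real.sqrt F₂ := Real.sqrt_nonneg _
  have hsP0 : 0 ≤ Real.sqrt (FX + FY) := Real.sqrt_nonneg _
  -- chain the inequalities
  have step1 : F₂ ^ 3 ≤ A₀ ^ 2 * F4 := by
    calc F₂ ^ 3 ≤ I1 ^ 2 * F4 := hInterp
      _ ≤ A₀ ^ 2 * F4 := mul_le_mul_of_nonneg_right (pow_le_pow_left₀ hI10 hI1A 2)
          (setIntegral_nonneg hS fun q _ => by positivity)
  have step2 : F4 ≤ (L⁻¹ * F₂ + 2 * Real.sqrt F₂ * Real.sqrt (FX + FY)) * (2 * Real.sqrt F₂ * Real.sqrt (FX + FY)) := by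
    refine hLady.trans (mul_le_mul ?_ ?_ (by positivity) (by positivity))
    · have h := mul_le_mul_of_nonneg_left hsX (by positivity : (0:ℝ) ≤ 2 * Real.sqrt F₂)
      linarith
    · exact mul_le_mul_of_nonneg_left hsY (by positivity : (0:ℝ) ≤ 2 * Real.sqrt F₂)
  have step3 : (L⁻¹ * F₂ + 2 * Real.sqrt F₂ * Real.sqrt (FX + FY)) * (2 * Real.sqrt F₂ * Real.sqrt (FX + FY)) =
      2 * L⁻¹ * (F₂ * Real.sqrt F₂) * Real.sqrt (FX + FY) + 4 * F₂ * (FX + FY) := by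
    have e : (L⁻¹ * F₂ + 2 * Real.sqrt F₂ * Real.sqrt (FX + FY)) * (2 * Real.sqrt F₂ * Real.sqrt (FX + FY)) =
        2 * L⁻¹ * (F₂ * Real.sqrt F₂) * Real.sqrt (FX + FY) +
          4 * (Real.sqrt F₂ * Real.sqrt F₂) * (Real.sqrt (FX + FY) * Real.sqrt (FX + FY)) := by ring
    rw [e, hsF, hsP]
  calc F₂ ^ 3 ≤ A₀ ^ 2 * F4 := step1
    _ ≤ A₀ ^ 2 * ((L⁻¹ * F₂ + 2 * Real.sqrt F₂ * Real.sqrt (FX + FY)) * (2 * Real.sqrt F₂ * Real.sqrt (FX + FY))) :=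
        mul_le_mul_of_nonneg_left step2 (sq_nonneg _)
    _ = _ := by rw [step3]

end NashSlice

/-! ## The uniform enstrophy bound -/

section Enstrophy

/-- **Uniform-in-time enstrophy bound (registered sub-goal `stub_vorticityUniformBounds_enstrophy`).** For every
classical solution of the stretched two-dimensional Navier–Stokes layer system on `(0, ∞)` (`ν, L > 0`) with
uniform exponential shear tails on compact time intervals there is `B` with `∫_{(0,L]} ∫_ℝ ω(t)² ≤ B` for all
`t ≥ 1` — step (c′) of the a-priori chain: with `A₀ = ‖ω(½)‖₁ + 1 ≥ ‖ω(τ)‖₁` (`τ ≥ ½`, Kato, tools H), the cut-off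
enstrophy `N_R(τ) = ∫∫ ω²ψ_R²` is differentiable (tools L) with
`N_R′ ≤ F₂ − ν‖∇(ωψ_R)‖² + c/R` (tools K, L; `F₂ = N_R`), while `‖∇(ωψ_R)‖²` dominates `F₂` superlinearly above the
threshold `K(A₀, ν, L)` (cylinder Ladyzhenskaya, tools I, J: `F₂ − 2(ν/4)‖∇f‖² < 0`); so `N_R′ < 0` wherever
`N_R > K ≥ 1` once `c/R ≤ 1`, the barrier on `[1, t]` gives `N_R(t) ≤ max(N_R(1), K) ≤ max(Ω(1), K)`, and
`R → ∞`. [folklore] -/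
theorem stub_vorticityUniformBounds_enstrophy : ∀ (ν L : ℝ), 0 < ν → 0 < L → ∀ (u v p : ℝ → ℝ → ℝ → ℝ),
    IsStretchedLayerNSSolutionOn (Ioi 0) ν 1 1 L u v p →
    (∀ a b : ℝ, 0 < a → a < b → ExpTails (Icc a b) u v) →
      ∃ B : ℝ, ∀ t : ℝ, 1 ≤ t → (∫ x in Ioc 0 L, ∫ y, vorticity (u t) (v t) x y ^ 2) ≤ B := by
  intro ν L hν hL u v p hsol htails
  set ω : ℝ → ℝ → ℝ → ℝ := fun τ => vorticity (u τ) (v τ) with hωdef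
  have hS : MeasurableSet (Ioc (0:ℝ) L ×ˢ (univ : Set ℝ)) := measurableSet_Ioc.prod MeasurableSet.univ
  -- slice facts from the tails on an interval `[a, b]`
  have cω : ∀ {τ : ℝ}, 0 < τ → Continuous fun q : ℝ × ℝ => ω τ q.1 q.2 := fun hτ =>
    (contDiff_one_vorticity (hsol.contDiff_u (mem_Ioi.2 hτ)) (hsol.contDiff_v (mem_Ioi.2 hτ))).continuous
  have hfacts : ∀ {a b τ : ℝ}, 0 < a → a < b → τ ∈ Icc a b → ∃ C k : ℝ, 0 < k ∧ 0 ≤ C ∧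
      SliceTails C k (u τ) (v τ) ∧ (∀ x y, |ω τ x y| ≤ C * Real.exp (-k * |y|)) ∧
      IntegrableOn (fun q : ℝ × ℝ => |ω τ q.1 q.2|) (Ioc 0 L ×ˢ univ) ∧
      IntegrableOn (fun q : ℝ × ℝ => ω τ q.1 q.2 ^ 2) (Ioc 0 L ×ˢ univ) := by
    intro a b τ ha hab hτ
    obtain ⟨C, k, hk, hCk⟩ := htails a b ha hab
    have hT : SliceTails C k (u τ) (v τ) := (hCk τ hτ).1
    have hC : 0 ≤ C := hT.nonneg
    have hτ0 : 0 < τ := ha.trans_le hτ.1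
    have hωb : ∀ x y, |ω τ x y| ≤ C * Real.exp (-k * |y|) := tails_abs_vorticity_le hT
    have hle1 : ∀ y : ℝ, Real.exp (-k * |y|) ≤ 1 := fun y => Real.exp_le_one_iff.2 (by nlinarith [abs_nonneg y])
    refine ⟨C, k, hk, hC, hT, hωb, ?_, ?_⟩
    · exact integrableOn_strip_of_abs_le_exp (cω hτ0).abs hC hk fun x _ y => by rw [abs_abs]; exact hωb x y
    · refine integrableOn_strip_of_abs_le_exp ((cω hτ0).pow 2) (by positivity : 0 ≤ C ^ 2) hk fun x _ y => ?_
      rw [abs_of_nonneg (sq_nonneg _)]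
      have h1 := hωb x y
      have h2 : |ω τ x y| ≤ C := h1.trans (mul_le_of_le_one_right hC (hle1 y))
      calc ω τ x y ^ 2 = |ω τ x y| * |ω τ x y| := by rw [← sq, sq_abs]
        _ ≤ C * (C * Real.exp (-k * |y|)) := mul_le_mul h2 h1 (abs_nonneg _) hC
        _ = C ^ 2 * Real.exp (-k * |y|) := by ring
  -- the `L¹` bound `A₀` from Kato
  set A₀ : ℝ := (∫ q in Ioc 0 L ×ˢ univ, |ω (1 / 2) q.1 q.2|) + 1 with hA₀
  have hA₀pos : 0 < A₀ := by
    have : 0 ≤ ∫ q in Ioc 0 L ×ˢ univ, |ω (1 / 2) q.1 q.2| := setIntegral_nonneg hS fun q _ => abs_nonneg _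
    linarith
  have hL1 : ∀ {τ : ℝ}, 1 / 2 ≤ τ → ∫ q in Ioc 0 L ×ˢ univ, |ω τ q.1 q.2| ≤ A₀ := by
    intro τ hτ
    obtain ⟨-, -, -, -, -, -, iτ, -⟩ := hfacts (a := 1 / 4) (b := τ + 1) (τ := τ) (by norm_num) (by linarith)
      ⟨by linarith, by linarith⟩
    obtain ⟨-, -, -, -, -, -, ih, -⟩ := hfacts (a := 1 / 4) (b := τ + 1) (τ := 1 / 2) (by norm_num) (by linarith)
      ⟨by norm_num, by linarith⟩
    have h := stub_vorticityUniformBounds_kato ν L hν hL u v p hsol htails (1 / 2) τ (by norm_num) hτ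
    rw [integral_iterated_eq_strip iτ, integral_iterated_eq_strip ih] at h
    simp only [hA₀]
    linarith
  -- the threshold and the bound
  set K : ℝ := max (4 * A₀ ^ 2 / (ν / 4)) (max 1 (8 * A₀ ^ 4 / (ν / 4 * L ^ 2))) with hK
  have hK1 : 1 ≤ K := (le_max_left _ _).trans (le_max_right _ _)
  set Ω1 : ℝ := ∫ q in Ioc 0 L ×ˢ univ, ω 1 q.1 q.2 ^ 2 with hΩ1
  refine ⟨max Ω1 K, fun t ht => ?_⟩
  obtain ⟨C, k, hk, hC, hTt, hωbt, iω1, iω2⟩ := hfacts (a := 1 / 2) (b := t + 1) (τ := t) (by norm_num)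
    (by linarith) ⟨by linarith, by linarith⟩
  rw [integral_iterated_eq_strip iω2]
  rcases eq_or_lt_of_le ht with rfl | ht1
  · exact le_max_left _ _
  -- tails on `[1/2, t+1]` and the cutoff constants
  obtain ⟨C, k, hk, hCk⟩ := htails (1 / 2) (t + 1) (by norm_num) (by linarith)
  have hST : ∀ τ ∈ Icc (1 / 2) (t + 1), SliceTails C k (u τ) (v τ) := fun τ hτ => (hCk τ hτ).1
  have hC : 0 ≤ C := (hST 1 ⟨by norm_num, by linarith⟩).nonneg
  obtain ⟨Cσ, hCσ0, hCσ⟩ := kato_smoothTransition_deriv_bound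
  set IW : ℝ := ∫ q in Ioc 0 L ×ˢ univ, (C + |q.2|) * Real.exp (-k * |q.2|) with hIW
  set Ik : ℝ := ∫ q in Ioc 0 L ×ˢ univ, Real.exp (-k * |q.2|) with hIk
  have hIW0 : 0 ≤ IW := setIntegral_nonneg hS fun q _ => by positivity
  have hIk0 : 0 ≤ Ik := setIntegral_nonneg hS fun q _ => (Real.exp_pos _).le
  set c₀ : ℝ := 2 * Cσ * C ^ 2 * (2 * IW + 4 * ν * Cσ * Ik + 4 * ν * Ik) with hc₀
  have hc₀0 : 0 ≤ c₀ := by positivity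
  -- the claim at a fixed large cutoff level
  have hclaim : ∀ R : ℝ, max 1 c₀ ≤ R → ∫ q in Ioc 0 L ×ˢ univ, ω t q.1 q.2 ^ 2 *
      (Real.smoothTransition (2 - q.2 / R) * Real.smoothTransition (2 + q.2 / R)) ^ 2 ≤ max Ω1 K := by
    intro R hR
    have hR1 : 1 ≤ R := (le_max_left _ _).trans hR
    have hR : 0 < R := one_pos.trans_le hR1
    have hc₀R : c₀ ≤ R := (le_max_right _ _).trans ‹max 1 c₀ ≤ R›
    set ψ : ℝ → ℝ := fun y => Real.smoothTransition (2 - y / R) * Real.smoothTransition (2 + y / R) with hψdef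
    have hψ : ContDiff ℝ 1 ψ := kato_cutoff_contDiff R
    have hψ0 : ∀ y, 0 ≤ ψ y := fun y => kato_cutoff_nonneg R y
    have hψ1 : ∀ y, ψ y ≤ 1 := fun y => kato_cutoff_le_one R y
    have hψ1' : ∀ y, |ψ y| ≤ 1 := fun y => kato_cutoff_abs_le_one R y
    have hψR : ∀ y, 2 * R ≤ |y| → ψ y = 0 := fun y hy => kato_cutoff_eq_zero hR hy
    have hψ'b : ∀ y, |deriv ψ y| ≤ 2 * Cσ / R := fun y => kato_cutoff_deriv_bound hR hCσ y
    have hψ'0 : ∀ y, 2 * R < |y| → deriv ψ y = 0 := fun y hy => kato_cutoff_deriv_eq_zero_of_gt hR hy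
    have hD : 0 ≤ 2 * Cσ / R := by positivity
    have hDle : 2 * Cσ / R ≤ 2 * Cσ := div_le_self (by positivity) hR1
    have hθ : ContDiff ℝ 1 (fun y => ψ y ^ 2) := hψ.pow 2
    have hθ1 : ∀ y, |ψ y ^ 2| ≤ 1 := fun y => by
      rw [abs_of_nonneg (sq_nonneg _)]; nlinarith [hψ0 y, hψ1 y]
    have hθR : ∀ y, 2 * R ≤ |y| → ψ y ^ 2 = 0 := fun y hy => by rw [hψR y hy]; ring
    -- the error is at most `1`
    have herr : 2 * Cσ / R * C ^ 2 * (2 * IW + 2 * ν * (2 * Cσ / R) * Ik + 4 * ν * Ik) ≤ 1 := by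
      have h1 : 2 * IW + 2 * ν * (2 * Cσ / R) * Ik + 4 * ν * Ik ≤ 2 * IW + 4 * ν * Cσ * Ik + 4 * ν * Ik := by
        nlinarith [mul_le_mul_of_nonneg_left hDle (by positivity : 0 ≤ 2 * ν * Ik)]
      have h2 : 2 * Cσ / R * C ^ 2 * (2 * IW + 2 * ν * (2 * Cσ / R) * Ik + 4 * ν * Ik) ≤ c₀ / R := by
        simp only [hc₀]
        rw [show 2 * Cσ / R * C ^ 2 * (2 * IW + 2 * ν * (2 * Cσ / R) * Ik + 4 * ν * Ik) =
          (2 * Cσ * C ^ 2 * (2 * IW + 2 * ν * (2 * Cσ / R) * Ik + 4 * ν * Ik)) / R by ring]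
        exact div_le_div_of_nonneg_right (mul_le_mul_of_nonneg_left h1 (by positivity)) hR.le
      exact h2.trans ((div_le_one hR).2 hc₀R)
    -- the cut-off enstrophy and its derivative
    set N : ℝ → ℝ := fun τ => ∫ q in Ioc 0 L ×ˢ univ, ω τ q.1 q.2 ^ 2 * ψ q.2 ^ 2 with hN
    have hderivN : ∀ τ ∈ Ioo (1 / 2) (t + 1), HasDerivAt N (2 * ∫ q in Ioc 0 L ×ˢ univ, ω τ q.1 q.2 * ψ q.2 ^ 2 *
        (dX (fun x y => deriv (fun s => v s x y) τ) q.1 q.2 - dY (fun x y => deriv (fun s => u s x y) τ) q.1 q.2)) τ :=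
      fun τ hτ => kato_hasDerivAt_enstrophy hsol.contDiffOn_u hsol.contDiffOn_v hθ hθ1 hθR L
        (by norm_num : (0:ℝ) < 1 / 2) hτ
    have hcontN : ContinuousOn N (Icc 1 t) := fun τ hτ =>
      (hderivN τ ⟨by linarith [hτ.1], by linarith [hτ.2]⟩).continuousAt.continuousWithinAt
    have hnegN : ∀ τ ∈ Ioc 1 t, K < N τ → ∃ D', HasDerivAt N D' τ ∧ D' < 0 := by
      intro τ hτ hKN
      have hτI : τ ∈ Ioo (1 / 2) (t + 1) := ⟨by linarith [hτ.1], by linarith [hτ.2]⟩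
      have hτ0 : 0 < τ := by linarith [hτ.1]
      have hτ' : τ ∈ Ioi (0:ℝ) := hτ0
      refine ⟨_, hderivN τ hτI, ?_⟩
      have hTτ := hST τ ⟨by linarith [hτ.1], by linarith [hτ.2]⟩
      -- the slice inequality
      have hslice := stub_vorticityUniformBounds_enstrophySlice hsol hν.le hL hτ0 hk hTτ hψ hψ1' (R := R) (D := 2 * Cσ / R)
        hψR hψ'b hψ'0
      -- `N τ = F₂`
      have eN : N τ = ∫ q in Ioc 0 L ×ˢ univ, (ω τ q.1 q.2 * ψ q.2) ^ 2 := by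
        simp only [hN]; exact integral_congr_ae (Eventually.of_forall fun q => by simp only; ring)
      rw [eN] at hKN
      -- Nash for `f = ω(τ)ψ`
      have hu2 := hsol.contDiff_u hτ'; have hv2 := hsol.contDiff_v hτ'
      have hdivτ := hsol.divFree τ hτ'
      have hω1 : ContDiff ℝ 1 (fun q : ℝ × ℝ => ω τ q.1 q.2) := contDiff_one_vorticity hu2 hv2
      have hωper : ∀ x y, ω τ (x + L) y = ω τ x y := fun x y => by
        simp only [hωdef, vorticity]; rw [dX_periodic (hsol.periodic_v τ hτ'), dY_periodic (hsol.periodic_u τ hτ')]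
      have hωb : ∀ x y, |ω τ x y| ≤ C * Real.exp (-k * |y|) := tails_abs_vorticity_le hTτ
      have hωx : ∀ x y, |dX (ω τ) x y| ≤ C * Real.exp (-k * |y|) := fun x y => by
        rw [show ω τ = vorticity (u τ) (v τ) from rfl, ← lap_eq_dX_vorticity hu2 hv2 hdivτ]
        exact hTτ.abs_lap_v_le x y
      have hωy : ∀ x y, |dY (ω τ) x y| ≤ C * Real.exp (-k * |y|) := kato_abs_dY_vorticity_le hTτ hu2 hv2 hdivτ
      have hnash := kato_nash_slice hL hk hω1 hωper hωb hωx hωy hψ hψ1' hD hψ'b (hL1 (by linarith [hτ.1]))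
      set F₂ : ℝ := ∫ q in Ioc 0 L ×ˢ univ, (ω τ q.1 q.2 * ψ q.2) ^ 2 with hF₂
      set Pf : ℝ := ∫ q in Ioc 0 L ×ˢ univ, (dX (fun x y => ω τ x y * ψ y) q.1 q.2 ^ 2 +
        dY (fun x y => ω τ x y * ψ y) q.1 q.2 ^ 2) with hPf
      have hF₂0 : 0 ≤ F₂ := setIntegral_nonneg hS fun q _ => sq_nonneg _
      have hPf0 : 0 ≤ Pf := setIntegral_nonneg hS fun q _ => by positivity
      have halt := kato_nash_alternative hF₂0 hPf0 hA₀pos hL hnash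
      have hneg := kato_enstrophy_rhs_neg (ν := ν / 4) (by positivity) hA₀pos hL halt hKN
      have hF₂1 : 1 < F₂ := lt_of_le_of_lt hK1 hKN
      linarith [hslice, herr, hneg]
    -- the barrier on `[1, t]`
    have hbar := kato_barrier_Icc hcontN hnegN (right_mem_Icc.2 ht1.le)
    have hN1 : N 1 ≤ Ω1 := by
      obtain ⟨-, -, -, -, -, -, -, i1⟩ := hfacts (a := 1 / 2) (b := t + 1) (τ := 1) (by norm_num) (by linarith)
        ⟨by norm_num, by linarith⟩
      simp only [hN, hΩ1]
      refine integral_mono ?_ i1 fun q => ?_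
      · exact kato_integrableOn_strip_of_eq_zero (R := 2 * R) (((cω one_pos).pow 2).mul
          (((kato_cutoff_contDiff R).continuous.comp continuous_snd).pow 2)) fun x _ y hy => by
          rw [hψR y hy]; ring
      · simp only
        have h := hθ1 q.2
        rw [abs_of_nonneg (sq_nonneg _)] at h
        nlinarith [sq_nonneg (ω 1 q.1 q.2)]
    calc N t ≤ max (N 1) K := hbar
      _ ≤ max Ω1 K := max_le_max hN1 le_rfl
  -- `R → ∞`
  have hlim : Tendsto (fun R : ℝ => ∫ q in Ioc 0 L ×ˢ univ, ω t q.1 q.2 ^ 2 *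
      (Real.smoothTransition (2 - q.2 / R) * Real.smoothTransition (2 + q.2 / R)) ^ 2) atTop
      (𝓝 (∫ q in Ioc 0 L ×ˢ univ, ω t q.1 q.2 ^ 2)) := by
    have ht0 : 0 < t := by linarith
    refine tendsto_integral_filter_of_dominated_convergence (fun q => ω t q.1 q.2 ^ 2) ?_ ?_ iω2 ?_
    · exact Eventually.of_forall fun R =>
        (((cω ht0).pow 2).mul (((kato_cutoff_contDiff R).continuous.comp continuous_snd).pow 2)).aestronglyMeasurable
    · refine Eventually.of_forall fun R => Eventually.of_forall fun q => ?_
      rw [Real.norm_eq_abs, abs_mul, abs_of_nonneg (sq_nonneg _), abs_of_nonneg (sq_nonneg _)]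
      have hc1 := kato_cutoff_le_one R q.2
      have hc0 := kato_cutoff_nonneg R q.2
      have hsq : (Real.smoothTransition (2 - q.2 / R) * Real.smoothTransition (2 + q.2 / R)) ^ 2 ≤ 1 := by
        nlinarith
      exact mul_le_of_le_one_right (sq_nonneg _) hsq
    · refine Eventually.of_forall fun q => tendsto_const_nhds.congr' ?_
      filter_upwards [eventually_ge_atTop |q.2|, eventually_gt_atTop (0:ℝ)] with R h1 h2
      rw [kato_cutoff_eq_one h2 h1]; ring
  exact le_of_tendsto hlim (by
    filter_upwards [eventually_ge_atTop (max 1 c₀)] with R hR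
    exact hclaim R hR)

end Enstrophy

end Summit.AnomalousDissipation.AnomalousDissipation.Theorems.StrainedLayerLaw.StrainWorkSumRule

end
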